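import Summits.ResolutionOfSingularities.ResolutionOfSingularities.Theorems.ValuativeLuAlphaPTorsorAdaptedValueStepSaturation
import Summits.ResolutionOfSingularities.ResolutionOfSingularities.Theorems.ValuativeLuAlphaPTorsorAdaptedValueStepRecursion
import HarnessLib

/-!
# `Valuative.LuAlphaPTorsor`, line `pfaff-line-log-final-forms`: the ADAPTED value step (F6v)

Crux `Valuative.LuAlphaPTorsor` (stmt-ResolutionOfSingularities-0641), line `pfaff-line-log-final-forms`,
registered stub `stub_adaptedValueStep` (F6v, wave 2: the ADAPTED value step of the purely
inseparable tower, any rank), PROVED here (statement verbatim from the ledger registration, reshape v6.3).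

**Claim.** Flag-adapted chart `(R, x, lv)` along `O` (any rank), values of `K^×` torsion over
the lattice of the `v(xᵢ)`, `t ^ p = x^α u` (`u` a unit of `R` of value `1`), `v(t)` outside the
lattice: then some finitely generated `R'` with `R[t] ⊆ R' ⊆ Frac (R[t]) ∩ O` carries a
FLAG-ADAPTED chart. **Proof.** (1) `adValue_construct` (file IV): S4's toric re-basing and the
hypothesis F¹ give `R₁ = R[y]`, a very good chart with flag-adapted values, `xᵢ = y^(cᵢ) wᵢ`.
(2) `adValue_satur_core` (file VII): at every level `ℓ` of `y`, the ideal of elements of `R₁`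
smaller than all low `y`-monomials is the saturation of `(y_h : lv' h ≥ ℓ)` by low monomials
(values of `R` are monomial values level by level, file III; no defect between the two flags,
file V; separation of the powers of `θ`, file VI). (3) `adValue_recursion` (file VIII): type-2
transforms `y'_j = y_j / y^(D j)` chosen level by level (Hilbert's basis theorem) make these
ideals of `R' = R₁[y']` generated by the high `y'_h` — this is (C3); the values of `y'` stay
flag-adapted, `ℤ`-independent and `< 1` (file I), the centre of `R'` is `(y')`
(`perron_span_eq_centre`), and beyond the top level smallness forces `z = 0` by the torsion
hypothesis. [folklore: Zariski 1940; Cutkosky 2022 §4 (very good parameters adapted to the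
composite structure, type-2 transforms dividing the high parameters by low monomials).]
-/

noncomputable section

-- `Summit.<S>.<S>.…` duplicates the summit name by design (D-0017, single-problem summit).
set_option linter.dupNamespace false

open IsLocalRing

namespace Summit.ResolutionOfSingularities.ResolutionOfSingularities.Theorems.PfaffLine

open Literature.AlgebraicGeometry.Resolution

/-! ### The stub -/

/-- **Stub `stub_adaptedValueStep` (F6v) of the line `pfaff-line-log-final-forms`** (crux
`Valuative.LuAlphaPTorsor`, stmt-ResolutionOfSingularities-0641): the ADAPTED value step of the
purely inseparable tower in any rank. See the module docstrings of the helper files for the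
proof (toric re-basing of S4, flag-adapted re-parametrization F¹, values of the old ring are
monomial values level by level, the saturation of the ideals of the high parameters in `R[y]`,
and type-2 transforms curing the hidden torsion level by level). -/
theorem stub_adaptedValueStep :
    ∀ p : ℕ, p.Prime → (∀ (Γ₀ : Type) [LinearOrderedCommGroupWithZero Γ₀] (n : ℕ) (τ : Fin n → Γ₀), (∀ i, τ i ≠ 0) → (∀ m : Fin n → ℤ, (∏ i, τ i ^ (m i)) = 1 → m = 0) → ∀ (H : Finset (Fin n → ℤ)), (∀ h ∈ H, (∏ i, τ i ^ (h i)) ≤ 1) → ∃ (C D : Matrix (Fin n) (Fin n) ℤ), C * D = 1 ∧ D * C = 1 ∧ (∀ j, (∏ i, τ i ^ (C j i)) < 1) ∧ (∀ h ∈ H, ∃ e : Fin n → ℕ, ∀ i, h i = ∑ j, (e j : ℤ) * C j i) ∧ ∃ lv : Fin n → ℕ, FlagAdaptedValues (fun j => ∏ i, τ i ^ (C j i)) lv) → ∀ (k K : Type) [Field k] [Field K] [Algebra k K] (O : ValuationSubring K) (n : ℕ) (R : Subalgebra k K) (hRO : R.toSubring ≤ O.toSubring) (x : Fin n → K) (hx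 : ∀ i, x i ∈ R) (lv : Fin n → ℕ), FlagAdaptedChart O R hRO x hx lv → (∀ z : K, z ≠ 0 → ∃ N : ℕ, N ≠ 0 ∧ ∃ m : Fin n → ℤ, O.valuation z ^ N = ∏ i, O.valuation (x i) ^ (m i)) → ∀ (t u : K) (α : Fin n → ℕ), u ∈ R → u⁻¹ ∈ R → O.valuation u = 1 → t ^ p = (∏ i, x i ^ (α i)) * u → (∀ m : Fin n → ℤ, O.valuation t ≠ ∏ i, O.valuation (x i) ^ (m i)) → ∃ (R' : Subalgebra k K) (hR'O : R'.toSubring ≤ O.toSubring) (y : Fin n → K) (hy : ∀ i, y i ∈ R') (lv' : Fin n → ℕ), R ≤ R' ∧ t ∈ R' ∧ ((R' : Set K) ⊆ Subfield.closure ((R : Set K) ∪ {t})) ∧ FlagAdaptedChart O R' hR'O y hy lv' ∧ (∀ i, ∃ (d : Fin n → ℕ) (w : K), w ∈ R' ∧ O.valuation w = 1 ∧ x i = (∏ j, y j ^ (d j)) * w) := by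
  intro p hp hF1 k K _ _ _ O n R hRO x hx lv hFAC htors t u α huR huiR hvu htp hvt
  classical
  obtain ⟨⟨hRfg, hx0, hcen, hind, ⟨hC2a, hC2b, hC4⟩, hC3⟩, hLA⟩ := hFAC
  -- ### the re-based chart `R₁ = R[y]` (S4 + F¹)
  obtain ⟨y, lv', c, w, f, wt, hR₁O, hyR₁, hymono, hy0, hvy1, hyind, ⟨⟨hC2a', hC2b', hC4'⟩, hLA'⟩,
    hxw, -, hRR₁, htR₁, hR₁fg, hR₁F, hcen₁⟩ :=
    adValue_construct hp hF1 O R hRO x hx hRfg hx0 hcen hind t u α huR huiR hvu htp hvt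
  set R₁ : Subalgebra k K := Algebra.adjoin k ((R : Set K) ∪ Set.range y) with hR₁
  have hvy0 : ∀ j, O.valuation (y j) ≠ 0 := fun j => (map_ne_zero _).mpr (hy0 j)
  -- ### saturation at every level, and the level recursion
  have hsat : ∀ (ℓ : ℕ) (z : K), z ∈ R₁ →
      (∀ m : Fin n → ℤ, (∀ j, ℓ ≤ lv' j → m j = 0) →
        O.valuation z < ∏ j, O.valuation (y j) ^ (m j)) →
      ∃ g : Fin n → ℕ, (∀ j, ℓ ≤ lv' j → g j = 0) ∧ ∃ b : Fin n → K, (∀ h, b h ∈ R₁) ∧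
        (∏ j, y j ^ (g j)) * z = ∑ h ∈ Finset.univ.filter (fun h => ℓ ≤ lv' h), y h * b h :=
    fun ℓ z hz hsm => adValue_satur_core O hp R hRO x hx lv hx0 hind hC2a hC4 hLA hC3 t u α huR
      huiR hvu htp hvt y lv' hy0 hvy1 hC2a' hymono c w (fun i => (hxw i).1) (fun i => (hxw i).2.1)
      (fun i => (hxw i).2.2) hR₁O ℓ z (adValue_poly_of_mem R y hz) hsm
  obtain ⟨D, hD, hgood⟩ := adValue_recursion O R₁ y lv' hy0 hyR₁ hR₁O hR₁fg hvy1 hC2a' hsat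
    (Finset.univ.sup lv' + 1)
  -- ### the final chart
  set y' : Fin n → K := fun j => y j * (∏ i, y i ^ (D j i))⁻¹ with hy'
  set R₃ : Subalgebra k K := Algebra.adjoin k ((R₁ : Set K) ∪ Set.range y') with hR₃
  have hR₁R₃ : R₁ ≤ R₃ := fun z hz => Algebra.subset_adjoin (Or.inl hz)
  have hy'R₃ : ∀ j, y' j ∈ R₃ := fun j => Algebra.subset_adjoin (Or.inr ⟨j, rfl⟩)
  have hvy' : ∀ j, O.valuation (y' j) = O.valuation (y j) * (∏ i, O.valuation (y i) ^ (D j i))⁻¹ :=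
    fun j => adValue_t2_val O y D j
  have hvy'1 : ∀ j, O.valuation (y' j) < 1 := fun j =>
    adValue_t2_val_lt_one O y lv' hy0 hvy1 hC2a' D hD j
  have hP0 : ∀ e : Fin n → ℕ, (∏ i, y i ^ (e i)) ≠ 0 := fun e =>
    Finset.prod_ne_zero_iff.mpr fun i _ => pow_ne_zero _ (hy0 i)
  have hy'0 : ∀ j, y' j ≠ 0 := fun j => mul_ne_zero (hy0 j) (inv_ne_zero (hP0 _))
  have hy'O : ∀ j, y' j ∈ O := fun j => (O.valuation_le_one_iff _).mp (hvy'1 j).le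
  have hR₃le : ∀ S : Subring K, R₁.toSubring ≤ S → (∀ j, y' j ∈ S) → R₃.toSubring ≤ S := by
    intro S h1 h2
    let Salg : Subalgebra k K := { S with algebraMap_mem' := fun c => h1 (R₁.algebraMap_mem c) }
    change R₃ ≤ Salg
    refine Algebra.adjoin_le ?_
    rintro z (hz | ⟨j, rfl⟩)
    exacts [h1 hz, h2 j]
  have hR₃O : R₃.toSubring ≤ O.toSubring := hR₃le O.toSubring hR₁O hy'O
  have hR₃fg : R₃.FG := by
    obtain ⟨S₀, hS₀⟩ := hR₁fg
    refine Subalgebra.fg_def.mpr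
      ⟨↑S₀ ∪ Set.range y', S₀.finite_toSet.union (Set.finite_range y'), ?_⟩
    rw [hR₃, Algebra.adjoin_union, Algebra.adjoin_union, hS₀, Algebra.adjoin_eq]
  have hR₃F : (R₃ : Set K) ⊆ Subfield.closure ((R : Set K) ∪ {t}) := fun z hz =>
    hR₃le (Subfield.closure ((R : Set K) ∪ {t})).toSubring (fun w hw => hR₁F hw)
      (fun j => show y' j ∈ Subfield.closure ((R : Set K) ∪ {t}) from
        mul_mem (hR₁F (hyR₁ j)) (inv_mem (prod_mem fun i _ => pow_mem (hR₁F (hyR₁ i)) _)))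
      hz
  have hyy' : ∀ j, y j = y' j * ∏ i, y i ^ (D j i) := fun j => by
    rw [hy', inv_mul_cancel_right₀ (hP0 _)]
  -- the centre
  have hyJ : ∀ j, (⟨y j, hR₁R₃ (hyR₁ j)⟩ : R₃.toSubring) ∈
      Ideal.span (Set.range fun j => (⟨y' j, hy'R₃ j⟩ : R₃.toSubring)) := by
    intro j
    have heq : (⟨y j, hR₁R₃ (hyR₁ j)⟩ : R₃.toSubring) = (⟨y' j, hy'R₃ j⟩ : R₃.toSubring) *
        ⟨∏ i, y i ^ (D j i), hR₁R₃ (R₁.prod_mem fun i _ => R₁.pow_mem (hyR₁ i) _)⟩ :=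
      Subtype.ext (hyy' j)
    rw [heq]
    exact Ideal.mul_mem_right _ _ (Ideal.subset_span ⟨j, rfl⟩)
  have hcen₃ := perron_span_eq_centre O R₁ hR₁O y hyR₁ hcen₁ y' R₃ rfl hR₃O hR₁R₃ hy'R₃ hvy'1 hyJ
  -- the values of `y'`
  have hτ : (fun j => O.valuation (y' j)) =
      fun j => O.valuation (y j) * (∏ i, O.valuation (y i) ^ (D j i))⁻¹ := funext hvy'
  have hind₃ : ∀ m : Fin n → ℤ, (∏ j, O.valuation (y' j) ^ (m j)) = 1 → m = 0 := fun m hm =>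
    adValue_t2_indep (fun j => O.valuation (y j)) lv' D hvy0 hD hyind m (by
      simpa only [hvy'] using hm)
  have hC2a₃ : ∀ i i', lv' i < lv' i' → ∀ m : Fin n → ℤ, (∀ j, lv' i < lv' j → m j = 0) →
      O.valuation (y' i') < ∏ j, O.valuation (y' j) ^ (m j) := by
    simp only [hvy']
    exact adValue_t2_C2a (fun j => O.valuation (y j)) lv' D hvy0 hC2a' hvy1 hD
  have hAV₃ : AdaptedValues (fun j => O.valuation (y' j)) lv' := by
    rw [hτ]
    exact ⟨adValue_t2_C2a (fun j => O.valuation (y j)) lv' D hvy0 hC2a' hvy1 hD,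
      adValue_t2_C2b (fun j => O.valuation (y j)) lv' D hvy0 hC2a' hC2b' hvy1 hD,
      adValue_t2_C4 (fun j => O.valuation (y j)) lv' D hvy0 hD hC4'⟩
  have hLA₃ : LevelArchimedean (fun j => O.valuation (y' j)) lv' := by
    rw [hτ]
    exact adValue_t2_levelArch (fun j => O.valuation (y j)) lv' D hvy0 hD hC4' hLA'
  -- ### (C3) for the final chart
  have hC3₃ : ∀ (ℓ : ℕ) (z : R₃.toSubring),
      z ∈ Ideal.span (Set.range fun i : {i : Fin n // ℓ ≤ lv' i} =>
          (⟨y' i.1, hy'R₃ i.1⟩ : R₃.toSubring)) ↔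
        ∀ m : Fin n → ℤ, (∀ j, ℓ ≤ lv' j → m j = 0) →
          O.valuation (z : K) < ∏ j, O.valuation (y' j) ^ (m j) := by
    intro ℓ z
    have hY'0 : ∀ m : Fin n → ℤ, (∏ j, O.valuation (y' j) ^ (m j)) ≠ 0 := fun m =>
      Finset.prod_ne_zero_iff.mpr fun j _ => zpow_ne_zero _ ((map_ne_zero _).mpr (hy'0 j))
    constructor
    · -- the ideal is small
      intro hz m hm
      obtain ⟨cf, hcf⟩ := Ideal.mem_span_range_iff_exists_fun.mp hz
      have hzeq : (z : K) = ∑ a : {i : Fin n // ℓ ≤ lv' i}, (cf a : K) * y' a.1 := by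
        rw [← hcf]; push_cast; rfl
      rw [hzeq]
      refine Valuation.map_sum_lt _ (hY'0 m) fun a _ => ?_
      rw [map_mul]
      exact lt_of_le_of_lt (mul_le_of_le_one_left' ((O.valuation_le_one_iff _).mpr
        (hR₃O (cf a).2))) (adValue_high_lt_low (fun j => O.valuation (y' j)) lv' hC2a₃ hvy'1 ℓ
          a.1 a.2 m hm)
    · intro hsm
      -- smallness with respect to the `y`-monomials of level `< ℓ`
      have hsmY : ∀ m : Fin n → ℤ, (∀ j, ℓ ≤ lv' j → m j = 0) →
          O.valuation (z : K) < ∏ j, O.valuation (y j) ^ (m j) := by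
        intro m hm
        obtain ⟨m', hm', heq⟩ := adValue_t2_lower_repr (fun j => O.valuation (y j)) lv' D hvy0 hD
          ℓ m hm
        rw [heq]
        simpa only [hvy'] using hsm m' hm'
      by_cases hH : ∃ h, ℓ ≤ lv' h
      · -- use the recursion at level `ℓ`
        obtain ⟨h₀, hh₀⟩ := hH
        have hℓ : ℓ < Finset.univ.sup lv' + 1 :=
          Nat.lt_succ_of_le (hh₀.trans (Finset.le_sup (f := lv') (Finset.mem_univ h₀)))
        obtain ⟨a₀, ha₀, b, hb, hzab⟩ := adValue_split R₁ y lv' D ℓ z.2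
        have hJsmall : ∀ m : Fin n → ℤ, (∀ j, ℓ ≤ lv' j → m j = 0) →
            O.valuation (∑ h ∈ Finset.univ.filter (fun h => ℓ ≤ lv' h), y' h * b h) <
              ∏ j, O.valuation (y j) ^ (m j) := by
          refine adValue_small_sum O y lv' hy0 _ _ ℓ fun h hh m hm => ?_
          refine adValue_small_mul O y lv' ((O.valuation_le_one_iff _).mpr (hR₃O (hb h))) ℓ
            (fun m hm => ?_) m hm
          obtain ⟨m', hm', heq⟩ := adValue_t2_lower_repr (fun j => O.valuation (y j)) lv' D hvy0
            hD ℓ m hm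
          rw [heq]
          have := adValue_high_lt_low (fun j => O.valuation (y' j)) lv' hC2a₃ hvy'1 ℓ h
            (Finset.mem_filter.mp hh).2 m' hm'
          simpa only [hvy'] using this
        have ha₀small : ∀ m : Fin n → ℤ, (∀ j, ℓ ≤ lv' j → m j = 0) →
            O.valuation a₀ < ∏ j, O.valuation (y j) ^ (m j) := by
          intro m hm
          have heq : a₀ = (z : K) + -(∑ h ∈ Finset.univ.filter (fun h => ℓ ≤ lv' h), y' h * b h) := by
            rw [hzab]; ring
          rw [heq]
          refine Valuation.map_add_lt _ (hsmY m hm) ?_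
          rw [Valuation.map_neg]
          exact hJsmall m hm
        obtain ⟨b₀, hb₀, ha₀b⟩ := hgood ℓ hℓ a₀ ha₀ ha₀small
        have hzsum : (z : K) = ∑ h ∈ Finset.univ.filter (fun h => ℓ ≤ lv' h), y' h * (b₀ h + b h) := by
          rw [hzab, ha₀b, ← Finset.sum_add_distrib]
          exact Finset.sum_congr rfl fun h _ => by ring
        have hzsum' : z = ∑ h ∈ Finset.univ.filter (fun h => ℓ ≤ lv' h),
            (⟨y' h, hy'R₃ h⟩ : R₃.toSubring) * ⟨b₀ h + b h, R₃.add_mem (hb₀ h) (hb h)⟩ :=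
          Subtype.ext (by push_cast; exact hzsum)
        rw [hzsum']
        refine Ideal.sum_mem _ fun h hh => ?_
        exact Ideal.mul_mem_right _ _ (Ideal.subset_span ⟨⟨h, (Finset.mem_filter.mp hh).2⟩, rfl⟩)
      · -- no parameter of level `≥ ℓ`: `z = 0` by torsion of the values
        push Not at hH
        suffices hz0 : z = 0 by rw [hz0]; exact Ideal.zero_mem _
        by_contra hz0
        have hz0' : (z : K) ≠ 0 := fun h => hz0 (Subtype.ext h)
        obtain ⟨N, hN, m, hm⟩ := htors _ hz0'
        have hvz1 : O.valuation (z : K) ≤ 1 := (O.valuation_le_one_iff _).mpr (hR₃O z.2)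
        have h1 : O.valuation (z : K) ^ N ≤ O.valuation (z : K) := pow_le_of_le_one zero_le hvz1 hN
        have h2 := hsmY (∑ i, m i • fun j => (c i j : ℤ)) fun j hj => absurd (hH j) (not_lt.mpr hj)
        rw [← adValue_vxmono O R hRO x hx0 y hy0 c w (fun i => (hxw i).1) (fun i => (hxw i).2.1)
          (fun i => (hxw i).2.2), ← hm] at h2
        exact absurd (h1.trans_lt h2) (lt_irrefl _)
  -- ### the old parameters are `ℕ`-monomials in `y'` times units
  have hxrepr : ∀ i, ∃ (d : Fin n → ℕ) (w' : K), w' ∈ R₃ ∧ O.valuation w' = 1 ∧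
      x i = (∏ j, y' j ^ (d j)) * w' := by
    intro i
    obtain ⟨hwR, hwiR, hxwi⟩ := hxw i
    have hE := adValue_t2_elem_repr y lv' hy0 D hD
    choose E hE using hE
    refine ⟨fun l => ∑ j, c i j * E j l, w i, hR₁R₃ (hRR₁ hwR), ?_, ?_⟩
    · have hw0 : w i ≠ 0 := fun h => hx0 i (by rw [hxwi, h, mul_zero])
      refine le_antisymm ((O.valuation_le_one_iff _).mpr (hRO hwR)) ?_
      have h2 := (O.valuation_le_one_iff _).mpr (hRO hwiR)
      rw [map_inv₀, inv_le_one₀ ((Valuation.pos_iff _).mpr hw0)] at h2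
      exact h2
    · rw [hxwi]
      congr 1
      have h1 : ∀ j, y j ^ (c i j) = ∏ l, y' l ^ (c i j * E j l) := fun j => by
        conv_lhs => rw [hE j]
        rw [← Finset.prod_pow]
        exact Finset.prod_congr rfl fun l _ => by rw [← pow_mul, Nat.mul_comm]
      rw [Finset.prod_congr rfl (fun j _ => h1 j), Finset.prod_comm]
      exact Finset.prod_congr rfl fun l _ => Finset.prod_pow_eq_pow_sum _ _ _
  exact ⟨R₃, hR₃O, y', hy'R₃, lv', hRR₁.trans hR₁R₃, hR₁R₃ htR₁, hR₃F,
    ⟨⟨hR₃fg, hy'0, hcen₃, hind₃, hAV₃, hC3₃⟩, hLA₃⟩, hxrepr⟩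


end Summit.ResolutionOfSingularities.ResolutionOfSingularities.Theorems.PfaffLine

end
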